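import Summits.ValiantsHypothesis.ValiantsHypothesis.Theorems.DepthWindowHomAtIterate
import Summits.ValiantsHypothesis.ValiantsHypothesis.Theorems.DepthWindowImmDivideConquer
import Summits.ValiantsHypothesis.ValiantsHypothesis.Theorems.DepthWindowHomLST
import Summits.ValiantsHypothesis.ValiantsHypothesis.Theorems.DepthWindowHomStacks
import Literature.Computability.Complexity.MCSPHardnessKabanetsCaiProofs
import HarnessLib
import HarnessLib.Audit

/-!
# DepthWindow — NO HOMOGENISATION BELOW SLOPE 2 OVER `ℂ`:
`p < 2q → ¬ HomAt p q c₀ a`; hence `¬ HomAtSlope p q` (`p < 2q`), `¬ HomSlope75`,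
and `HomRelStacks → ¬ HomRel k j` for `j < 2k`

Decomposition workshop decomp-valiant, lens 2 (gen 33), CALLED offer O7 (critic bus 898), STAGE 2,
second half.  LST's Lemma 11 homogenises a product-depth-`Δ` circuit at product depth `2Δ`
(char `0`); the dial `HomAt p q c₀ a` of `DepthWindowHomRel` asks for depth `⌊pΔ/q⌋ + c₀` at size
`(s+|σ|+2)^a · 2^{a d²}`, uniformly in `σ, d, f, D`.  THIS FILE: every slope `p/q < 2` is
impossible over `ℂ`, so the factor `2` of Lemma 11 is optimal in this currency.

Proof.  Assume `HomAt p q c₀ a`, `p < 2q`.  One ROUND = homogenise, then halve by the proved duality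
`dualityHalvingAt_eight` (`DepthWindowHomAtIterate.round_step`): general depth
`Δ ↦ (⌊pΔ/q⌋+c₀+1)/2`, a contraction; `T = 2q(⌊log₂Δ₀⌋+1)` rounds reach constant depth
`c₁ = 4q²(c₀+1)` at size `X₀^{E^T}`, `E = 24(a+1)` (`iterate_to_const`).  Start from the
divide-and-conquer circuit for `IMM_{n,d}` (`DepthWindowImmDivideConquer.exists_circuit_immPoly`:
depth `e+1`, size `≤ (4n²)^{e+1} = X₀` for `d = 2^e`), homogenise once more (depth
`≤ c₂ = ⌊p c₁/q⌋ + c₀ + 1`, size `≤ X₀^{3a·E^T}`), and compare with the homogeneous LST bound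
`homLst_geom_solved` (`DepthWindowHomLST`): `2^{⌊log₂ n⌋(λ-10)/(20c₂)} ≤ s·d^d + 1` whenever
`λ^{2^{c₂}-1}·2^{2^{c₂}} ≤ d` and `10d ≤ ⌊log₂ n⌋`.  With `λ = 2^v`, `e = v(2^{c₂}-1) + 2^{c₂}`,
`d = 2^e`, `n = 2^{20 c₂ L'}`, `L' = 2^{2e} + e2^e + 10d + 1` everything is a power of two and the
comparison is the natural-number inequality
`L'(2^v - 10) ≤ (2L+2)(e+1)E^T·3a + e2^e + 1 ≤ L'(42c₂(3a+1)(e+1)E^T + 1)`,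
refuted by `E^T ≤ (2(e+1))^{κ·2q}` (`κ = ⌊log₂E⌋+1`), `e+1 ≤ v·2^{c₂+1}` and the choice of `v` with
`C·v^k + 11 < 2^v` (`exists_lt_two_pow`, via the library's `KabanetsCai.sq_le_two_pow`).
No step uses anything about `ℂ` beyond `dualityHalvingAt_eight` and `homLst_geom_solved`.

Consequences recorded here (all over `ℂ`): `HomAtSlope p q := ∃ c₀ a, HomAt p q c₀ a`
(`DepthWindowSlopeRate`, which imports the route file and is therefore not imported here) is false for
every `p < 2q` by `fun ⟨_, _, h⟩ => not_homAt_of_lt_two_mul hp h` — in particular `¬ HomAtSlope 0 1`: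
the hypothesis of `DepthWindowSlopeRateZero.perHardLog3_of_homAtSlope_zero` is FALSE;
`not_homSlope75 : ¬ HomSlope75` (by `DepthWindow.homSlope75_iff` this is the negation of the route's
aside `HomSubReach`; the refutation of that Theses decl is filed separately); and
`not_homRel : 0 < k → j < 2k → ¬ HomRel k j` UNCONDITIONALLY (stacking `homRelStacks` is proved,
`DepthWindowHomStacks`): every cell `j < 2k` of the `HomRel` dial is dead — e.g. `HomRel 2 2`, `2 3`,
`3 4`, `4 5`, `5 7` of `DepthWindowHomSubReachOfBlock`; `¬ HomRel 1 1` was already in `DepthWindowHomEsymm`.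
Census cell W34 («lost factor 2», ceiling_lift (a) over `ℂ`): REFUTED — the `ℂ`-side of the
general-circuit window `(18/25, 1]` is reachable only through a homogeneous engine past slope `36/25`.
Nothing here is `S`-currency; rung 0; `VP ≠ VNP` untouched.

References: LimayeSrinivasanTavenas2021 (Lemma 11, Cor. 4); BhargavDuttaSaxena2024 (Thm. 1.4);
Burgisser2000 (Rem. 2.7).
-/

noncomputable section

open MvPolynomial

-- the summit and the problem share the name `ValiantsHypothesis` (D-0017 single-conjunct layout)
set_option linter.dupNamespace false

namespace Summit.ValiantsHypothesis.ValiantsHypothesis.Theorems.DepthWindowNotHomAtBelowTwo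

open Literature.Computability.AlgebraicComplexity ArithCircuit
open Summit.ValiantsHypothesis.ValiantsHypothesis.Theorems.DepthWindow
open Summit.ValiantsHypothesis.ValiantsHypothesis.Theorems.DepthWindowHomAtIterate
open Summit.ValiantsHypothesis.ValiantsHypothesis.Theorems.DepthWindowImmDivideConquer

/-! ### Elementary growth lemmas -/

/-- Exponential beats polynomial, in the crude explicit form used below:
`∃ v ≥ 4, C·v^k + 11 < 2^v` (take `v = 2^{C+k+5}`). [cite: LimayeSrinivasanTavenas2021, Cor. 4] -/
theorem exists_lt_two_pow (C k : ℕ) : ∃ v : ℕ, 4 ≤ v ∧ C * v ^ k + 11 < 2 ^ v := by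
  obtain ⟨w, hw⟩ : ∃ w, w = C + k + 5 := ⟨_, rfl⟩
  refine ⟨2 ^ w, ?_, ?_⟩
  · calc (4 : ℕ) = 2 ^ 2 := by norm_num
      _ ≤ 2 ^ w := Nat.pow_le_pow_right (by norm_num) (by omega)
  · have hC : C < 2 ^ C := Nat.lt_two_pow_self
    have hP : 0 < (2 ^ w) ^ k := pow_pos (pow_pos (by norm_num) _) _
    have h1 : C * (2 ^ w) ^ k < 2 ^ (C + w * k) := by
      calc C * (2 ^ w) ^ k < 2 ^ C * (2 ^ w) ^ k := mul_lt_mul_of_pos_right hC hP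
        _ = 2 ^ (C + w * k) := by rw [← pow_mul, ← pow_add]
    have h2 : (11 : ℕ) < 2 ^ 4 := by norm_num
    have h3 : 2 ^ (C + w * k) + 2 ^ 4 ≤ 2 ^ (C + w * k + 5) := by
      have ha : 2 ^ (C + w * k) ≤ 2 ^ (C + w * k + 4) :=
        Nat.pow_le_pow_right (by norm_num) (by omega)
      have hb : 2 ^ 4 ≤ 2 ^ (C + w * k + 4) :=
        Nat.pow_le_pow_right (by norm_num) (Nat.le_add_left 4 _)
      calc 2 ^ (C + w * k) + 2 ^ 4 ≤ 2 ^ (C + w * k + 4) + 2 ^ (C + w * k + 4) :=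
            Nat.add_le_add ha hb
        _ = 2 ^ (C + w * k + 5) := by ring
    have h4 : C + w * k + 5 ≤ 2 ^ w := by
      have hsq := Literature.Computability.Complexity.KabanetsCai.sq_le_two_pow (a := w) (by omega)
      have hwk : w * k + w ≤ w * w := by
        rw [← mul_add_one]; exact Nat.mul_le_mul_left w (by omega)
      have h5 : C + w * k + 5 ≤ w * k + w := by omega
      exact h5.trans (hwk.trans hsq)
    calc C * (2 ^ w) ^ k + 11 < 2 ^ (C + w * k) + 2 ^ 4 := add_lt_add h1 h2
      _ ≤ 2 ^ (C + w * k + 5) := h3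
      _ ≤ 2 ^ (2 ^ w) := Nat.pow_le_pow_right (by norm_num) h4

/-- `E^{⌊log₂(e+1)⌋+1} ≤ (2(e+1))^{⌊log₂E⌋+1}` (swap base and exponent through powers of two).
[cite: LimayeSrinivasanTavenas2021, Cor. 4] -/
theorem pow_log_succ_le (E e : ℕ) :
    E ^ (Nat.log 2 (e + 1) + 1) ≤ (2 * (e + 1)) ^ (Nat.log 2 E + 1) := by
  have hE : E < 2 ^ (Nat.log 2 E + 1) := Nat.lt_pow_succ_log_self one_lt_two E
  have hm : 2 ^ (Nat.log 2 (e + 1) + 1) ≤ 2 * (e + 1) := by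
    rw [pow_succ, mul_comm 2 (e + 1)]
    exact Nat.mul_le_mul_right 2 (Nat.pow_log_le_self 2 (show e + 1 ≠ 0 by omega))
  calc E ^ (Nat.log 2 (e + 1) + 1) ≤ (2 ^ (Nat.log 2 E + 1)) ^ (Nat.log 2 (e + 1) + 1) :=
        Nat.pow_le_pow_left hE.le _
    _ = (2 ^ (Nat.log 2 (e + 1) + 1)) ^ (Nat.log 2 E + 1) := by
        rw [← pow_mul, ← pow_mul, mul_comm]
    _ ≤ (2 * (e + 1)) ^ (Nat.log 2 E + 1) := Nat.pow_le_pow_left hm _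

/-! ### The main theorem -/

/-- **No homogenisation below slope `2` over `ℂ`.**  For `p < 2q` the uniform homogenisation
statement `HomAt p q c₀ a` (product depth `Δ ↦ ⌊pΔ/q⌋ + c₀`, size `(s+|σ|+2)^a·2^{a d²}`) is false:
iterating it against the proved duality halving contradicts the homogeneous LST lower bound for
`IMM`.  LST Lemma 11's factor `2` is therefore optimal in this currency.
[cite: LimayeSrinivasanTavenas2021, Lemma 11, Cor. 4] [cite: BhargavDuttaSaxena2024, Thm. 1.4] -/
theorem not_homAt_of_lt_two_mul {p q c₀ a : ℕ} (hp : p < 2 * q) : ¬ HomAt p q c₀ a := by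
  intro hH
  have hT : DualityHalvingAt 8 := dualityHalvingAt_eight
  have hq : 1 ≤ q := by omega
  -- constants of the iteration
  obtain ⟨c₁, hc₁⟩ : ∃ c₁, c₁ = 4 * q * (q * (c₀ + 1)) := ⟨_, rfl⟩
  obtain ⟨c₂, hc₂⟩ : ∃ c₂, c₂ = p * c₁ / q + c₀ + 1 := ⟨_, rfl⟩
  have hc₂1 : 1 ≤ c₂ := by rw [hc₂]; exact Nat.le_add_left 1 _
  obtain ⟨M, hM⟩ : ∃ M, M = 2 ^ c₂ - 1 := ⟨_, rfl⟩
  obtain ⟨M₂, hM₂⟩ : ∃ M₂, M₂ = M + 2 ^ c₂ + 1 := ⟨_, rfl⟩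
  obtain ⟨E, hE⟩ : ∃ E, E = 24 * (a + 1) := ⟨_, rfl⟩
  obtain ⟨κ, hκ⟩ : ∃ κ, κ = Nat.log 2 E + 1 := ⟨_, rfl⟩
  -- the free parameter `v` (`λ = 2^v`)
  obtain ⟨v, hv4, hv⟩ :=
    exists_lt_two_pow (42 * c₂ * (3 * a + 1) * M₂ * (2 * M₂) ^ (κ * (2 * q))) (κ * (2 * q) + 1)
  have hv16 : 16 ≤ 2 ^ v := by
    calc (16 : ℕ) = 2 ^ 4 := by norm_num
      _ ≤ 2 ^ v := Nat.pow_le_pow_right (by norm_num) hv4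
  obtain ⟨e, he⟩ : ∃ e, e = v * M + 2 ^ c₂ := ⟨_, rfl⟩
  obtain ⟨d, hd⟩ : ∃ d, d = 2 ^ e := ⟨_, rfl⟩
  have hd1 : 1 ≤ d := by rw [hd]; exact Nat.one_le_two_pow
  obtain ⟨L', hL'⟩ : ∃ L', L' = 2 ^ (2 * e) + e * 2 ^ e + 10 * d + 1 := ⟨_, rfl⟩
  have hL'1 : 1 ≤ L' := by rw [hL']; exact Nat.le_add_left 1 _
  obtain ⟨L, hL⟩ : ∃ L, L = 20 * c₂ * L' := ⟨_, rfl⟩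
  have hL'L : L' ≤ L := by
    rw [hL]
    have := Nat.mul_le_mul_right L' (show 1 ≤ 20 * c₂ by omega)
    simpa using this
  have hL1 : 1 ≤ L := hL'1.trans hL'L
  obtain ⟨n, hn⟩ : ∃ n, n = 2 ^ L := ⟨_, rfl⟩
  have hlog : Nat.log 2 n = L := by rw [hn]; exact Nat.log_pow (by norm_num) _
  have hn2 : 2 ≤ n := by
    rw [hn]
    calc (2 : ℕ) = 2 ^ 1 := by norm_num
      _ ≤ 2 ^ L := Nat.pow_le_pow_right (by norm_num) hL1
  -- the start circuit: divide and conquer for `IMM_{n,d}`, depth `e+1`, size `≤ (2n²+n+2)^{e+1}`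
  obtain ⟨C₀, hC₀, hC₀d, hC₀s⟩ := exists_circuit_immPoly ℂ n (d := d) (e := e) hd1 (by rw [hd])
  -- the common ceiling `X₀ = 2^{(2L+2)(e+1)}`
  obtain ⟨X₀, hX₀⟩ : ∃ X₀, X₀ = 2 ^ ((2 * L + 2) * (e + 1)) := ⟨_, rfl⟩
  have hexp1 : 1 ≤ (2 * L + 2) * (e + 1) :=
    le_trans (by norm_num) (Nat.mul_le_mul (show 1 ≤ 2 * L + 2 by omega) (show 1 ≤ e + 1 by omega))
  have hX₀2 : 2 ≤ X₀ := by
    rw [hX₀]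
    calc (2 : ℕ) = 2 ^ 1 := by norm_num
      _ ≤ 2 ^ ((2 * L + 2) * (e + 1)) := Nat.pow_le_pow_right (by norm_num) hexp1
  have hcard : Fintype.card (Fin d × Fin n × Fin n) = d * (n * n) := by
    simp [Fintype.card_prod, Fintype.card_fin]
  have hLe : L ≤ (2 * L + 2) * (e + 1) :=
    calc L ≤ 2 * L + 2 := by omega
      _ ≤ (2 * L + 2) * (e + 1) := Nat.le_mul_of_pos_right _ (by omega)
  have hLe' : e + 2 * L + 1 ≤ (2 * L + 2) * (e + 1) := by
    have h := Nat.le_mul_of_pos_left e (show 0 < 2 * L + 2 by omega)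
    calc e + 2 * L + 1 ≤ (2 * L + 2) * e + (2 * L + 2) := by omega
      _ = (2 * L + 2) * (e + 1) := by ring
  have hN : Fintype.card (Fin d × Fin n × Fin n) + 2 ≤ X₀ := by
    rw [hcard, hX₀, hd, hn]
    have h1 : 2 ^ e * (2 ^ L * 2 ^ L) = 2 ^ (e + 2 * L) := by rw [two_mul, pow_add, pow_add]
    have h2 : 2 ^ (e + 2 * L) + 2 ≤ 2 ^ (e + 2 * L + 1) := by
      have : 2 ≤ 2 ^ (e + 2 * L) := by
        calc (2 : ℕ) = 2 ^ 1 := by norm_num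
          _ ≤ 2 ^ (e + 2 * L) := Nat.pow_le_pow_right (by norm_num) (by omega)
      calc 2 ^ (e + 2 * L) + 2 ≤ 2 ^ (e + 2 * L) + 2 ^ (e + 2 * L) := Nat.add_le_add_left this _
        _ = 2 ^ (e + 2 * L + 1) := by ring
    have h3 : 2 ^ (e + 2 * L + 1) ≤ 2 ^ ((2 * L + 2) * (e + 1)) :=
      Nat.pow_le_pow_right (by norm_num) hLe'
    rw [h1]; exact h2.trans h3
  have hdX : 2 ^ (d * d) ≤ X₀ := by
    rw [hX₀, hd]
    apply Nat.pow_le_pow_right (by norm_num)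
    have h1 : 2 ^ e * 2 ^ e = 2 ^ (2 * e) := by rw [two_mul, pow_add]
    have h2 : 2 ^ (2 * e) ≤ L' := by
      rw [hL']; exact le_add_right (le_add_right (Nat.le_add_right _ _))
    rw [h1]; exact h2.trans (hL'L.trans hLe)
  have hs : C₀.size ≤ X₀ := by
    rw [hX₀]
    refine hC₀s.trans ?_
    rw [pow_mul 2 (2 * L + 2) (e + 1)]
    apply Nat.pow_le_pow_left
    have h4 : 2 ^ (2 * L + 2) = 4 * (n * n) := by rw [hn]; ring
    have h5 : n * 2 ≤ n * n := Nat.mul_le_mul_left n hn2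
    rw [h4, Nat.mul_assoc]; omega
  -- `T` rounds of «homogenise, then halve»: constant depth `c₁`, size `≤ X₀^{E^T}`
  have hf : (immPoly n d ℂ).IsHomogeneous d := immPoly_isHomogeneous_holds (k := ℂ) n d
  obtain ⟨D₁, hD₁, hD₁d, hD₁s⟩ := iterate_to_const hp hH hT hf hC₀ hX₀2 hN hdX hs hC₀d
  have hD₁c₁ : D₁.productDepth ≤ c₁ := by rw [hc₁]; exact hD₁d
  obtain ⟨T, hTdef⟩ : ∃ T, T = 2 * q * (Nat.log 2 (e + 1) + 1) := ⟨_, rfl⟩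
  obtain ⟨Y, hY⟩ : ∃ Y, Y = X₀ ^ (E ^ T) := ⟨_, rfl⟩
  have hD₁Y : D₁.size ≤ Y := by rw [hY, hE, hTdef]; exact hD₁s
  have hE1 : 1 ≤ E := by rw [hE]; omega
  have hX₀Y : X₀ ≤ Y := by
    rw [hY]
    calc X₀ = X₀ ^ 1 := (pow_one _).symm
      _ ≤ X₀ ^ (E ^ T) := Nat.pow_le_pow_right (by omega) (Nat.one_le_pow _ _ (by omega))
  -- one more homogenisation: every gate homogeneous, depth `≤ c₂`, size `≤ Y^{3a}`
  obtain ⟨D₂, hD₂, hD₂hom, hD₂d, hD₂s⟩ := hH _ d _ hf D₁ hD₁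
  have hD₂c₂ : D₂.productDepth ≤ c₂ := by
    rw [hc₂]; refine hD₂d.trans ?_
    have h6 : p * D₁.productDepth / q ≤ p * c₁ / q :=
      Nat.div_le_div_right (Nat.mul_le_mul_left p hD₁c₁)
    exact (Nat.add_le_add_right h6 c₀).trans (Nat.le_succ _)
  have hS : D₂.size ≤ Y ^ (3 * a) :=
    hD₂s.trans (hom_cost_le (hX₀2.trans hX₀Y) (hN.trans hX₀Y) (hdX.trans hX₀Y) hD₁Y)
  -- the homogeneous LST bound at `Δ = c₂`, `λ = 2^v`
  have hlam : (1 : ℝ) ≤ (2 : ℝ) ^ v := by exact_mod_cast Nat.one_le_two_pow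
  have hfit : ((2 : ℝ) ^ v) ^ (2 ^ c₂ - 1) * 2 ^ (2 ^ c₂) ≤ (d : ℝ) := by
    rw [hd, he, hM, ← pow_mul, ← pow_add]; exact_mod_cast le_rfl
  have hdn : 10 * d ≤ Nat.log 2 n := by
    rw [hlog]; exact le_trans (by rw [hL']; exact le_add_right (Nat.le_add_left _ _)) hL'L
  have hlst := homLst_geom_solved ℂ hc₂1 n d hd1 hlam hfit hdn D₂ hD₂c₂ hD₂hom hD₂
  rw [hlog, hL] at hlst
  have hv10 : 10 ≤ 2 ^ v := le_trans (by norm_num) hv16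
  have hexp : ((20 * c₂ * L' : ℕ) : ℝ) * ((2 : ℝ) ^ v - 10) / (20 * (c₂ : ℝ)) =
      ((L' * (2 ^ v - 10) : ℕ) : ℝ) := by
    have hc : (20 * (c₂ : ℝ)) ≠ 0 := by
      have : (c₂ : ℝ) ≠ 0 := by exact_mod_cast (show c₂ ≠ 0 by omega)
      exact mul_ne_zero (by norm_num) this
    rw [div_eq_iff hc]
    push_cast [Nat.cast_sub hv10]
    ring
  rw [hexp, Real.rpow_natCast] at hlst
  have hnat : 2 ^ (L' * (2 ^ v - 10)) ≤ D₂.size * d ^ d + 1 := by exact_mod_cast hlst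
  -- the upper bound `s·d^d + 1 ≤ 2^{A + e2^e + 1}`, `A = (2L+2)(e+1)·E^T·3a`
  have hdd : d ^ d = 2 ^ (e * 2 ^ e) := by rw [hd, ← pow_mul]
  obtain ⟨A, hA⟩ : ∃ A, A = (2 * L + 2) * (e + 1) * E ^ T * (3 * a) := ⟨_, rfl⟩
  have hYA : Y ^ (3 * a) = 2 ^ A := by
    rw [hY, hX₀, ← pow_mul, ← pow_mul, hA]
    congr 1; ring
  have hSA : D₂.size ≤ 2 ^ A := hS.trans (le_of_eq hYA)
  have hup : D₂.size * d ^ d + 1 ≤ 2 ^ (A + e * 2 ^ e + 1) := by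
    rw [hdd]
    have h1 : D₂.size * 2 ^ (e * 2 ^ e) ≤ 2 ^ (A + e * 2 ^ e) := by
      rw [pow_add]; exact Nat.mul_le_mul_right _ hSA
    have h2 : 1 ≤ 2 ^ (A + e * 2 ^ e) := Nat.one_le_two_pow
    calc D₂.size * 2 ^ (e * 2 ^ e) + 1 ≤ 2 ^ (A + e * 2 ^ e) + 2 ^ (A + e * 2 ^ e) :=
          Nat.add_le_add h1 h2
      _ = 2 ^ (A + e * 2 ^ e + 1) := by ring
  have hle : L' * (2 ^ v - 10) ≤ A + e * 2 ^ e + 1 := by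
    by_contra hlt
    have h7 : 2 ^ (A + e * 2 ^ e + 1) < 2 ^ (L' * (2 ^ v - 10)) :=
      Nat.pow_lt_pow_right (by norm_num) (not_le.mp hlt)
    exact absurd (hnat.trans hup) (not_le.mpr h7)
  -- the final count: `A + e2^e + 2 ≤ L'(42c₂(3a+1)(e+1)E^T + 1) ≤ L'(2^v - 10)`
  have hET : E ^ T ≤ (2 * (e + 1)) ^ (κ * (2 * q)) := by
    rw [hTdef, hκ, mul_comm (2 * q) _, pow_mul E (Nat.log 2 (e + 1) + 1) (2 * q),
      pow_mul (2 * (e + 1)) (Nat.log 2 E + 1) (2 * q)]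
    exact Nat.pow_le_pow_left (pow_log_succ_le E e) _
  have heM : e + 1 ≤ v * M₂ := by
    have h1 : 2 ^ c₂ ≤ v * 2 ^ c₂ := Nat.le_mul_of_pos_left _ (by omega)
    have h2 : 1 ≤ v := by omega
    calc e + 1 = v * M + 2 ^ c₂ + 1 := by rw [he]
      _ ≤ v * M + v * 2 ^ c₂ + v := Nat.add_le_add (Nat.add_le_add_left h1 _) h2
      _ = v * M₂ := by rw [hM₂]; ring
  have hbig : (e + 1) * E ^ T ≤ M₂ * (2 * M₂) ^ (κ * (2 * q)) * v ^ (κ * (2 * q) + 1) := by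
    calc (e + 1) * E ^ T ≤ (v * M₂) * (2 * (v * M₂)) ^ (κ * (2 * q)) :=
          Nat.mul_le_mul heM (hET.trans (Nat.pow_le_pow_left (Nat.mul_le_mul_left 2 heM) _))
      _ = M₂ * (2 * M₂) ^ (κ * (2 * q)) * v ^ (κ * (2 * q) + 1) := by
          rw [show 2 * (v * M₂) = (2 * M₂) * v by ring, mul_pow]; ring
  have hG : 42 * c₂ * (3 * a + 1) * ((e + 1) * E ^ T) + 11 < 2 ^ v := by
    have h1 := Nat.mul_le_mul_left (42 * c₂ * (3 * a + 1)) hbig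
    have hre : 42 * c₂ * (3 * a + 1) * (M₂ * (2 * M₂) ^ (κ * (2 * q)) * v ^ (κ * (2 * q) + 1)) =
        42 * c₂ * (3 * a + 1) * M₂ * (2 * M₂) ^ (κ * (2 * q)) * v ^ (κ * (2 * q) + 1) := by
      ring
    rw [hre] at h1
    exact lt_of_le_of_lt (Nat.add_le_add_right h1 11) hv
  have hA_le : A ≤ L' * (42 * c₂ * (3 * a + 1) * ((e + 1) * E ^ T)) := by
    rw [hA, hL]
    have hcl : 1 ≤ c₂ * L' := by simpa using Nat.mul_le_mul hc₂1 hL'1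
    have h1 : 2 * (20 * c₂ * L') + 2 ≤ 42 * c₂ * L' := by
      rw [show 2 * (20 * c₂ * L') + 2 = 40 * (c₂ * L') + 2 by ring,
        show 42 * c₂ * L' = 42 * (c₂ * L') by ring]
      omega
    calc (2 * (20 * c₂ * L') + 2) * (e + 1) * E ^ T * (3 * a)
        ≤ 42 * c₂ * L' * (e + 1) * E ^ T * (3 * a + 1) :=
          Nat.mul_le_mul (Nat.mul_le_mul_right _ (Nat.mul_le_mul_right _ h1)) (Nat.le_succ _)
      _ = L' * (42 * c₂ * (3 * a + 1) * ((e + 1) * E ^ T)) := by ring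
  have hL'2 : e * 2 ^ e + 2 ≤ L' := by
    have h22 : 1 ≤ 2 ^ (2 * e) := Nat.one_le_two_pow
    rw [hL']; omega
  have hG1 : 42 * c₂ * (3 * a + 1) * ((e + 1) * E ^ T) + 1 ≤ 2 ^ v - 10 := by omega
  have hfin : A + e * 2 ^ e + 2 ≤ L' * (2 ^ v - 10) := by
    calc A + e * 2 ^ e + 2 ≤ L' * (42 * c₂ * (3 * a + 1) * ((e + 1) * E ^ T)) + L' := by omega
      _ = L' * (42 * c₂ * (3 * a + 1) * ((e + 1) * E ^ T) + 1) := by ring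
      _ ≤ L' * (2 ^ v - 10) := Nat.mul_le_mul_left L' hG1
  omega

/-! ### Consequences -/

/-- Denominator `0` is slope `0`: `HomAt p 0 c₀ a → HomAt 0 1 c₀ a` (`⌊pΔ/0⌋ = 0` in `ℕ`).
[cite: LimayeSrinivasanTavenas2021, Lemma 11] -/
theorem homAt_den_zero {p c₀ a : ℕ} (h : HomAt p 0 c₀ a) : HomAt 0 1 c₀ a := by
  intro σ _ d f hf D hD
  obtain ⟨D', h1, h2, h3, h4⟩ := h σ d f hf D hD
  refine ⟨D', h1, h2, ?_, h4⟩
  simp only [Nat.div_zero, zero_add] at h3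
  simpa using h3

/-- `¬ HomAt p 0 c₀ a`. [cite: LimayeSrinivasanTavenas2021, Lemma 11] -/
theorem not_homAt_den_zero {p c₀ a : ℕ} : ¬ HomAt p 0 c₀ a :=
  fun h => not_homAt_of_lt_two_mul (p := 0) (q := 1) (by norm_num) (homAt_den_zero h)

/-- **No homogenisation below slope 2**, both parametrisations of "below": `p < 2q` or `q = 0`.
[cite: LimayeSrinivasanTavenas2021, Lemma 11] -/
theorem not_homAt {p q c₀ a : ℕ} (hpq : p < 2 * q ∨ q = 0) : ¬ HomAt p q c₀ a := by
  rcases hpq with h | rfl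
  · exact not_homAt_of_lt_two_mul h
  · exact not_homAt_den_zero

/-- **`¬ HomSlope75`**: homogenisation at some slope `≤ 7/5` is impossible over `ℂ`
(`HomSlope75 ↔ HomSubReach`, the aside of route `DepthWindow`, by `DepthWindow.homSlope75_iff`).
[cite: LimayeSrinivasanTavenas2021, Lemma 11] [cite: BhargavDuttaSaxena2024, Thm. 1.4] -/
theorem not_homSlope75 : ¬ HomSlope75 := by
  rintro ⟨p, q, c₀, a, hpq, h⟩
  rcases Nat.eq_zero_or_pos q with rfl | hq
  · exact not_homAt_den_zero h
  · exact not_homAt_of_lt_two_mul (by omega) h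

/-- **Given stacking, every cell `j < 2k` of the `HomRel` dial is dead**:
`HomRelStacks → 0 < k → j < 2k → ¬ HomRel k j`. [cite: LimayeSrinivasanTavenas2021, Lemma 11] -/
theorem not_homRel_of_stacks (hs : HomRelStacks) {k j : ℕ} (hk : 0 < k) (hj : j < 2 * k) :
    ¬ HomRel k j := by
  intro h
  obtain ⟨c₀, a, hH⟩ := hs k j hk h
  exact not_homAt_of_lt_two_mul hj hH

/-- **Unconditionally** (stacking is PROVED in the tree: `homRelStacks`, `DepthWindowHomStacks`):
every relative block lemma `HomRel k j` with `0 < k` and `j < 2k` is false over `ℂ` — e.g.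
`not_homRel (by norm_num) (by norm_num) : ¬ HomRel 5 7`, likewise `HomRel 2 2`, `2 3`, `3 4`, `4 5`
(the named cells of `DepthWindowHomSubReachOfBlock`); slope exactly `2` (`HomRel 1 2`,
`homAtSlope_two_one`) is LST Lemma 11 and true.
[cite: LimayeSrinivasanTavenas2021, Lemma 11, Lemma 19, Lemma 20] -/
theorem not_homRel {k j : ℕ} (hk : 0 < k) (hj : j < 2 * k) : ¬ HomRel k j :=
  not_homRel_of_stacks homRelStacks hk hj

end Summit.ValiantsHypothesis.ValiantsHypothesis.Theorems.DepthWindowNotHomAtBelowTwo
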